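import Mathlib
import HarnessLib
import Summits.ResolutionOfSingularities.ResolutionOfSingularities.Theorems.WildQuotientsWildQuotientResolutionTerminalBlowupModel
import Summits.ResolutionOfSingularities.ResolutionOfSingularities.Theorems.WildQuotientsWildQuotientResolutionLinearSmallBlocksAlgebra
import Summits.ResolutionOfSingularities.ResolutionOfSingularities.Theorems.WildQuotientsWildQuotientResolutionLinearSmallBlocksAssembly
import Literature.AlgebraicGeometry.Resolution.AffineBlowupUniversal

/-!
# Rung LSB: every coordinate `ℤ/p`-action with Jordan blocks `≤ 2` is resolved by one blow-up
(crux stmt-ResolutionOfSingularities-15640 `WildQuotients.WildQuotientResolution`, line `Sketch`;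
chain w45c `L/w45c/CHAIN.md` v3 §4/§5 rung LSB, stub-2 «LSB model» + the final composition)

[OURS · L1 W4.5c; NOT a statement of the manuscript.] For a `k`-algebra automorphism `σ` of
`k[x_1, …, x_n]` of the form `σ xᵢ = xᵢ + x_{f i}` (`i ∈ D`), `σ xᵢ = xᵢ` (`i ∉ D`) with
`f(D) ∩ D = ∅` (a linear unipotent action with Jordan blocks of size `≤ 2`, in coordinates; `D`
non-empty; characteristic `p`, so `⟨σ⟩ ≅ ℤ/p`), the blow-up `V = Bl_I 𝔸ⁿ` of the
`σ`-fixed coordinate subspace `I = (x_{f i} : i ∈ D)` with the lifted action is a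
Király–Lütkebohmert terminal model (`linearSmallBlocks_terminalModel`: the seven model-side
hypotheses of `CyclicTransfer.cyclicDivisorialTransfer_of_card`, from the generic
`TerminalBlowup.liftAction_terminal_spec` p471334 and stub-3's LSB algebra / coordinate-subspace
blow-up `LinearSmallBlocks.*`), hence (`LinearSmallBlocks.linearSmallBlocks_hasResolution_of_model`,
stub-3) **`linearSmallBlocks_hasResolution`: `𝔸ⁿ/⟨σ⟩` has a resolution of singularities** —
unconditionally, for every prime `p` and every `n`. Instances: `𝔸⁴/(J₂ ⊕ J₂)`
(`TwoBlocks.twoJordanBlocksFourfold_hasResolution`, p470649), `𝔸²ᵐ/(J₂^{⊕m})`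
(`NBlocks.nBlocksQuotient_hasResolution`, p470928; non-Cohen–Macaulay for `m ≥ 3`), and every
linear `ℤ/2`-action in characteristic `2` up to coordinates.
-/

-- single-problem summit: the doubled namespace component `ResolutionOfSingularities` is forced
set_option linter.dupNamespace false

noncomputable section

open CategoryTheory AlgebraicGeometry TopologicalSpace MvPolynomial
open Literature.AlgebraicGeometry.Resolution

namespace Summit.ResolutionOfSingularities.ResolutionOfSingularities.Theorems.WildQuotientResolution.LinearSmallBlocks

/-- **The terminal model of rung LSB** (the hypothesis `hmodel` of
`linearSmallBlocks_hasResolution_of_model`): for `σ xᵢ = xᵢ + x_{f i}` (`i ∈ D`), `σ xᵢ = xᵢ`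
(`i ∉ D`), `f(D) ∩ D = ∅`, `D ≠ ∅`, characteristic `p`, and the action `ρ g = Spec (g⁻¹)` of
`⟨σ⟩` on `𝔸ⁿ`, the blow-up of `I = (x_{f i} : i ∈ D)` with the lifted action is proper,
birational, integral, regular (`coordSubspace_blowup_regular`), `π`-equivariant, covered by
`⟨σ⟩`-stable affine opens, and has principal stalk augmentation ideals at fixed points
(`TerminalBlowup.liftAction_terminal_spec` with generators `x_{f i}`: fixed (`smul_X_of_not_mem`),
`g • b - b ∈ I` (`smul_sub_mem_centre`), `x_{f i} ∈ ⟨g • b - b⟩` for `g ≠ 1`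
(`X_mem_augIdeal_of_transvection`)). [folklore; assembly of landed decls] -/
theorem linearSmallBlocks_terminalModel (p : ℕ) (hp : p.Prime) (k : Type) [Field k] [CharP k p]
    (n : ℕ) (σ : MvPolynomial (Fin n) k ≃ₐ[k] MvPolynomial (Fin n) k)
    (D : Finset (Fin n)) (f : Fin n → Fin n) (hfD : ∀ i ∈ D, f i ∉ D) (hD : D.Nonempty)
    (hσD : ∀ i ∈ D, σ (X i) = X i + X (f i)) (hσ : ∀ i ∉ D, σ (X i) = X i)
    (ρ : ↥(Subgroup.zpowers σ) →* Aut (Spec (CommRingCat.of (MvPolynomial (Fin n) k))))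
    (hρ : ∀ g : ↥(Subgroup.zpowers σ), (ρ g).hom = Spec.map (CommRingCat.ofHom
      ((MulSemiringAction.toRingEquiv (↥(Subgroup.zpowers σ)) (MvPolynomial (Fin n) k) g⁻¹ :
        MvPolynomial (Fin n) k ≃+* MvPolynomial (Fin n) k) :
          MvPolynomial (Fin n) k →+* MvPolynomial (Fin n) k))) :
    ∃ (V : Scheme.{0}) (π : V ⟶ Spec (CommRingCat.of (MvPolynomial (Fin n) k)))
      (ρV : ↥(Subgroup.zpowers σ) →* Aut V), IsProper π ∧ IsBirational π ∧
      IsIntegral V ∧ Scheme.IsRegular V ∧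
      (∀ g : ↥(Subgroup.zpowers σ), (ρV g).hom ≫ π = π ≫ (ρ g).hom) ∧
      (∀ v : V, ∃ W : V.Opens, IsAffineOpen W ∧ v ∈ W ∧
        ∀ g : ↥(Subgroup.zpowers σ), (ρV g).hom ⁻¹ᵁ W = W) ∧
      (∀ (g : ↥(Subgroup.zpowers σ)) (v : V) (hv : (ρV g).hom.base v = v),
        (Ideal.span (Set.range fun s : V.presheaf.stalk v =>
          (V.presheaf.stalkSpecializes (specializes_of_eq hv) ≫ (ρV g).hom.stalkMap v).hom s -
            s)).IsPrincipal) := by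
  classical
  have hσp : σ ^ p = 1 := pow_prime_eq_one k n σ D f hfD hσD hσ p
  have hcard : Nat.card (Subgroup.zpowers σ) = p := card_zpowers k n σ D f hfD hσD hσ p hp hD
  haveI : Finite (↥(Subgroup.zpowers σ)) := Nat.finite_of_card_ne_zero (hcard ▸ hp.ne_zero)
  -- the centre and its blow-up
  set I : Ideal (MvPolynomial (Fin n) k) :=
    Ideal.span (X '' (f '' (↑D : Set (Fin n)))) with hI
  have hπ : IsBlowup (affineBlowup.π I) (affineBlowup.idealSheaf I) := affineBlowup.isBlowup I
  have hDS : (↑(D.image f) : Set (Fin n)) = f '' (↑D : Set (Fin n)) := Finset.coe_image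
  obtain ⟨hVreg, hVint, hVprop, hbir⟩ :
      Scheme.IsRegular (affineBlowup I) ∧ IsIntegral (affineBlowup I) ∧
        IsProper (affineBlowup.π I) ∧ IsBirational (affineBlowup.π I) := by
    have h := coordSubspace_blowup_regular k n (D.image f) (hD.image f)
    rw [hDS] at h
    exact h
  -- generators of the centre as a `Fin`-indexed family
  let cB : Fin (D.image f).toList.length → MvPolynomial (Fin n) k :=
    fun j => X ((D.image f).toList.get j)
  have hmemD : ∀ j, ∃ i ∈ D, f i = (D.image f).toList.get j := fun j => by
    have : (D.image f).toList.get j ∈ D.image f :=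
      Finset.mem_toList.mp (List.get_mem _ _)
    simpa [Finset.mem_image] using this
  have hcI : Ideal.span (Set.range cB) = I := by
    rw [hI, ← hDS]
    congr 1
    have : cB = X ∘ (D.image f).toList.get := rfl
    rw [this, Set.range_comp, Set.range_list_get]
    congr 1
    ext a
    simp
  have hIstab : ∀ (g : ↥(Subgroup.zpowers σ)) (b : MvPolynomial (Fin n) k),
      b ∈ I → g • b ∈ I := by
    intro g b hb
    have h := smul_centre_eq k n σ D f hfD hσ g
    rw [hI] at hb ⊢
    rw [← h]
    exact Ideal.smul_mem_pointwise_smul g b _ hb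
  -- every `g ≠ 1` has `I` as augmentation ideal with the invariant generators `x_{f i}`
  have hgen : ∀ g : ↥(Subgroup.zpowers σ), (∀ b : MvPolynomial (Fin n) k, g • b = b) ∨
      ((∀ j, g • cB j = cB j) ∧ (∀ b : MvPolynomial (Fin n) k, g • b - b ∈ I) ∧
        ∀ j, cB j ∈ Ideal.span (Set.range fun b : MvPolynomial (Fin n) k => g • b - b)) := by
    intro g
    by_cases hg : g = 1
    · left
      intro b
      rw [hg, one_smul]
    · right
      refine ⟨fun j => ?_, fun b => smul_sub_mem_centre k n σ D f hσD hσ g b, fun j => ?_⟩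
      · obtain ⟨i, hi, hfi⟩ := hmemD j
        change g • (X ((D.image f).toList.get j) : MvPolynomial (Fin n) k) =
          X ((D.image f).toList.get j)
        rw [← hfi]
        exact smul_X_of_not_mem k n σ D hσ g (f i) (hfD i hi)
      · obtain ⟨i, hi, hfi⟩ := hmemD j
        change (X ((D.image f).toList.get j) : MvPolynomial (Fin n) k) ∈ _
        rw [← hfi]
        exact X_mem_augIdeal_of_transvection k p hp σ (f i) i (hσ (f i) (hfD i hi)) (hσD i hi)
          hσp g hg
  obtain ⟨ρV, hequiv, hcov, hdiv⟩ :=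
    TerminalBlowup.liftAction_terminal_spec (k := k) ρ hρ I hIstab cB hcI hgen hπ
  exact ⟨affineBlowup I, affineBlowup.π I, ρV, hVprop, hbir, hVint, hVreg, hequiv, hcov, hdiv⟩

/-- **Rung LSB: `𝔸ⁿ/⟨σ⟩` has a resolution of singularities for every coordinate `ℤ/p`-action
with Jordan blocks of size `≤ 2`** (`σ xᵢ = xᵢ + x_{f i}` on `D ≠ ∅`, `σ xᵢ = xᵢ` off `D`,
`f(D) ∩ D = ∅`; every prime `p`, every `n`), unconditionally:
`linearSmallBlocks_hasResolution_of_model` fed with `linearSmallBlocks_terminalModel`. Contains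
`𝔸⁴/(J₂ ⊕ J₂)` (p470649) and the non-Cohen–Macaulay family `𝔸²ᵐ/(J₂^{⊕m})` (p470928).
[OURS · L1 W4.5c] [folklore; assembly of landed decls] -/
theorem linearSmallBlocks_hasResolution (p : ℕ) (hp : p.Prime) (k : Type) [Field k] [CharP k p]
    (n : ℕ) (σ : MvPolynomial (Fin n) k ≃ₐ[k] MvPolynomial (Fin n) k)
    (D : Finset (Fin n)) (f : Fin n → Fin n) (hfD : ∀ i ∈ D, f i ∉ D) (hD : D.Nonempty)
    (hσD : ∀ i ∈ D, σ (X i) = X i + X (f i)) (hσ : ∀ i ∉ D, σ (X i) = X i) :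
    Scheme.HasResolution
      (Spec (.of (FixedPoints.subalgebra k (MvPolynomial (Fin n) k) (Subgroup.zpowers σ)))) :=
  linearSmallBlocks_hasResolution_of_model p hp k n σ D f hfD hD hσD hσ
    fun ρ hρ => linearSmallBlocks_terminalModel p hp k n σ D f hfD hD hσD hσ ρ hρ

end Summit.ResolutionOfSingularities.ResolutionOfSingularities.Theorems.WildQuotientResolution.LinearSmallBlocks

end
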